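import Summits.Ventures.LatticeQCDFlow.Scaling.TaggedPerAttemptCertificateEveryEdge
import Summits.Ventures.LatticeQCDFlow.Scaling.TaggedPerAttemptCertificateLoneBetween

/-!
HONEST FRAMING: exact (Metropolis-corrected) sampling algorithms for lattice gauge theory; figures
of merit are autocorrelation/cost numbers at stated couplings and volumes; no continuum-physics
claim.

# TaggedPerAttemptCertificateEveryEdgeThree — CONJECTURE W′ ON EVERY ADJACENT EDGE FROM EVERY ORDINARY HUB, NO CONFIGURATION EXCLUDED, FOR EVERY `K ≥ 3`:
# `L·(x̃(★) + (x̃(a) − ỹ(a)) − D_J) ≥ cost(x̃) + cost(ỹ)` FOR EVERY TRUNCATION `J` (lean-2 GEN-42, ours)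

Venture-side (OURS).  Cell `lqcd-flow` (pub-lqcd), unit `pub-lqcd-lean-2-g42`, 2026-08-30.  Chapter AB (route (β), the cost side continued), file 17 — the final assembly: file 13
(every edge, every hub but the lone hub strictly between) and file 16 (the lone hub strictly between, `K ≥ 3`).  Hypotheses: W14∕W26's tagged chains of an adjacent pair (`W_b ≤ W_a`,
ANY present contents between the extra particles) from an ordinary hub `z` (`N_C(z) ≠ 0`), `K ≥ 3`; NOTHING ELSE.

* **`tagged_perAttempt_certificate_everyEdge_three`**: `cost(x̃) + cost(ỹ) ≤ L·(x̃(★) + (x̃(a) − ỹ(a)) − D_J)` for every `J`, `L = 2K + M_X + M_Y`,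
  `D_J = Σ_{n<J}(1−σ)σⁿ(y_{n+1}(z) − x_{n+1}(z))⁺`.

This is GEN-41 §0(a)'s demand — the per-attempt-count criterion of route (β) (MEMO-gen40 §4) on ALL adjacent edges — for `K ≥ 3`; at `K = 2` it holds on every edge but the lone hub
strictly between the extra particles (file 13; memo MEMO-gen42 §5).  What remains of OPEN-MATH (b′) is that `K = 2` corner, then `r_j` (C2) and C4 for the lumped star.
Literature grade (cell rule): OWN; nothing cited; no new bib keys.
-/

open Finset

namespace Summit.Ventures.LatticeQCDFlow.Scaling

section EveryEdgeThree
variable {S : Type*} [Fintype S] [DecidableEq S]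
variable {W θ : S → ℝ} {acc : S → S → ℝ} {p : ℝ} {K : ℕ} {NC : S → ℕ} {a b : S} {PX PY : Option S → Option S → ℝ}

/-- **CONJECTURE W′ ON EVERY ADJACENT EDGE FROM EVERY ORDINARY HUB, EVERY `K ≥ 3`** (see the module docstring). [ours] -/
theorem tagged_perAttempt_certificate_everyEdge_three (hW : ∀ v, 0 < W v) (hp0 : 0 ≤ p) (hp : ∀ v, p * W v ≤ 1) (hθ : ∀ v, θ v = 1 / (1 + p * W v))
    (hacc : ∀ h v, acc h v = min 1 (W h / W v)) (hK : 3 ≤ K) (hNC : ∑ v, NC v = K) (hab : W b ≤ W a)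
    (hPXoff : ∀ h v, h ≠ v → PX (some h) (some v) = if NC h = 0 then 0 else (NC v : ℝ) / K * acc h v)
    (hPXin : ∀ h, PX (some h) none = if NC h = 0 then 0 else acc h a / K)
    (hPXdiag : ∀ h, PX (some h) (some h) = 1 - (∑ v ∈ univ.erase h, PX (some h) (some v) + PX (some h) none))
    (hPXout : ∀ v, PX none (some v) = (NC v : ℝ) / K * acc a v) (hPXstay : PX none none = 1 - ∑ v, PX none (some v))
    (hPYoff : ∀ h v, h ≠ v → PY (some h) (some v) = if NC h = 0 then 0 else (NC v : ℝ) / K * acc h v)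
    (hPYin : ∀ h, PY (some h) none = if NC h = 0 then 0 else acc h b / K)
    (hPYdiag : ∀ h, PY (some h) (some h) = 1 - (∑ v ∈ univ.erase h, PY (some h) (some v) + PY (some h) none))
    (hPYout : ∀ v, PY none (some v) = (NC v : ℝ) / K * acc b v) (hPYstay : PY none none = 1 - ∑ v, PY none (some v))
    {z : S} (hz : NC z ≠ 0)
    {x y : ℕ → Option S → ℝ}
    (hx0 : ∀ v, x 0 v = if v = some z then 1 else 0) (hxs : ∀ n v, x (n + 1) v = ∑ h, x n h * PX h v)
    (hy0 : ∀ v, y 0 v = if v = some z then 1 else 0) (hys : ∀ n v, y (n + 1) v = ∑ h, y n h * PY h v)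
    {M : ℝ} (hM : M = ∑ v, θ v * (NC v : ℝ) + θ a) {L : ℝ} (hL : L = 2 * K + M + (∑ v, θ v * (NC v : ℝ) + θ b))
    {σ : ℝ} (hσ0 : 0 ≤ σ) (hσ1 : σ < 1) {xt yt xs ys : Option S → ℝ}
    (hxt : ∀ t, xt t = (1 - σ) * PX (some z) t + σ * ∑ t', xt t' * PX t' t) (hyt : ∀ t, yt t = (1 - σ) * PY (some z) t + σ * ∑ t', yt t' * PY t' t)
    (hxsr : ∀ t, xs t = (1 - σ) * PX none t + σ * ∑ t', xs t' * PX t' t) (hysr : ∀ t, ys t = (1 - σ) * PY none t + σ * ∑ t', ys t' * PY t' t) (J : ℕ) :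
    (∑ v, xt (some v) * (1 - θ v) + xt none * (1 - θ a)) + (∑ v, yt (some v) * (1 - θ v) + yt none * (1 - θ b))
      ≤ L * (xt none + (xt (some a) - yt (some a)) - ∑ n ∈ range J, (1 - σ) * σ ^ n * max 0 (y (n + 1) (some z) - x (n + 1) (some z))) := by
  have hK2 : 2 ≤ K := by omega
  by_cases hlone : W b < W z ∧ W z < W a ∧ NC z = 1 ∧ ∀ w, w ≠ z → NC w ≠ 0 → W w < W z
  · obtain ⟨hbz, hza, hz1, hbelow⟩ := hlone
    exact tagged_perAttempt_certificate_loneBetween hW hp0 hp hθ hacc hK hNC hab hPXoff hPXin hPXdiag hPXout hPXstay hPYoff hPYin hPYdiag hPYout hPYstay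
      hz1 hbz.le hza hbelow hx0 hxs hy0 hys hM hL hσ0 hσ1 hxt hyt hxsr hysr J
  · exact tagged_perAttempt_certificate_everyEdge hW hp0 hp hθ hacc hK2 hNC hab hPXoff hPXin hPXdiag hPXout hPXstay hPYoff hPYin hPYdiag hPYout hPYstay
      hz hlone hx0 hxs hy0 hys hM hL hσ0 hσ1 hxt hyt hxsr hysr J

end EveryEdgeThree

end Summit.Ventures.LatticeQCDFlow.Scaling
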